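import Summits.Ventures.CertifiedManyBodySolver.Rows.CorrWindowCertKernelChainQuotCloser
import HarnessLib

/-!
# GENERIC BOX GEOMETRY for kernel-replay instances: the `(2R+1) × (2R+1)` window as index tables — arithmetic `boxXs` / `boxIx`,
# membership, injectivity, cover, read-back, the letter maps `boxD` / `boxPush`, and the licensed-shift TABLE FACT — proved once for
# every `R`, so instances at `N = 169 / 625` prove nothing by enumeration

HONEST FRAMING: Lean plumbing towards «tier P» (HOME/STATUS «ANSWER (R0)–(R4)» 23:11:25Z, item (R3)(i)): the toys enumerate a 3 × 3
window by `![…]` literals and prove `xs_injective` / `xs_cover` / `xs_ix` by `decide` / `interval_cases`, which does not scale to the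
Rm2 geometry (outer window 25 × 25, inner 13 × 13). Here the window `boxW R = thicken {0} R` is enumerated ARITHMETICALLY
(`boxXs R i = (i / (2R+1) − R, i % (2R+1) − R)`, reader `boxIx R v = ((v₀+R) mod s)·s + (v₁+R) mod s`, `s = 2R+1`) and every
hypothesis the kernel-form closers ask of the tables is a theorem in `R`: `boxXs_mem`, `boxXs_boxIx` (read-back on the window),
`boxXs_injective`, `boxXs_cover`, the letter map `boxD R` with `boxD_orb` / `boxD_injective`, the push `boxPush r R` with `boxD_boxPush`
(= the `hf` hypothesis), window inclusions `boxW_mono` / `thicken_boxW_subset` / `zero_mem_boxW`, `D₄` invariance `d4Vec_mem_boxW`, and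
the TABLE FACT `box_hokV` (every move `(γ, v)` with `‖v‖∞ ≤ R − r` reads back on the outer tables) for the validator
`boxOk vmax`; `boxQuot r R vmax : QuotData` bundles the tables for `Rows/CorrWindowCertKernelChainQuot*.lean`. No certificate, no
number of record; CONTROL/CALIBRATION context (wording (xx1)); no summit statement is proved by this file. Seat hubbard-obs-p2
(STIFFNESS), `prover-hubbard-obs-p2-g23-0`, zero compute.

References: X. Han, arXiv:2006.06002 §3 (square-lattice windows and their symmetry) [Han2020Bootstrap]; S. Friedli, Y. Velenik,
*Statistical Mechanics of Lattice Systems* §3.2 (the boxes `B(n)`) [FriedliVelenikSMLS2017].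
-/

namespace Summit.Ventures.CertifiedManyBodySolver

namespace CARPolyWindow

open Summit.Ventures.CertifiedQuantumChemistry Summit.Ventures.CertifiedQuantumChemistry.CARPoly
open Literature.MathematicalPhysics.QuantumLattice Literature.MathematicalPhysics.QuantumLattice.HubbardWave0
open Literature.MathematicalPhysics.QuantumManyBody.StateRelaxation
open Literature.Probability.LatticeModels ThermodynamicLimit Filter Topology
open Matrix
open scoped ComplexOrder BigOperators

namespace BoxGeom

/-! ## The window and its arithmetic tables -/

/-- The `(2R+1) × (2R+1)` window centred at the origin, as the kernel form wants it (`thicken {0} R`). [cite: Han2020Bootstrap, §3] -/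
noncomputable def boxW (R : ℕ) : Finset (Site 2) := thicken ({0} : Finset (Site 2)) (R : ℝ)

/-- Membership in the window = both coordinates in `[−R, R]`. [cite: FriedliVelenikSMLS2017, §3.2] -/
theorem mem_boxW {R : ℕ} {x : Site 2} : x ∈ boxW R ↔ ∀ i, -(R : ℤ) ≤ x i ∧ x i ≤ R := by
  unfold boxW thicken
  simp only [Finset.singleton_biUnion, Finset.mem_image, zero_add, Nat.floor_natCast, exists_eq_right]
  exact mem_box

/-- The side length `2R + 1`. [folklore] -/
def side (R : ℕ) : ℕ := 2 * R + 1

/-- The number of sites `(2R+1)²`. [folklore] -/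
def boxN (R : ℕ) : ℕ := side R * side R

/-- The side is positive. [folklore] -/
theorem side_pos (R : ℕ) : 0 < side R := by unfold side; omega

/-- `boxN R` is positive (so `Fin (boxN R)` is inhabited and `NeZero`). [folklore] -/
theorem boxN_pos (R : ℕ) : 0 < boxN R := Nat.mul_pos (side_pos R) (side_pos R)

/-- `NeZero (boxN R)`. [folklore] -/
theorem neZero_boxN (R : ℕ) : NeZero (boxN R) := ⟨(boxN_pos R).ne'⟩

/-- **The arithmetic site enumeration**: index `i` ↦ `(i / (2R+1) − R, i % (2R+1) − R)`. [folklore] -/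
def boxXs (R : ℕ) (i : Fin (boxN R)) : Site 2 := ![((i.val / side R : ℕ) : ℤ) - R, ((i.val % side R : ℕ) : ℤ) - R]

/-- **The arithmetic index reader** (total; junk on sites outside the window). [folklore] -/
def boxIx (R : ℕ) (v : Site 2) : Fin (boxN R) :=
  ⟨((v 0 + R).toNat % side R) * side R + (v 1 + R).toNat % side R, by
    have hs := side_pos R
    have hx : (v 0 + R).toNat % side R < side R := Nat.mod_lt _ hs
    have hy : (v 1 + R).toNat % side R < side R := Nat.mod_lt _ hs
    calc (v 0 + ↑R).toNat % side R * side R + (v 1 + ↑R).toNat % side R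
        < (v 0 + ↑R).toNat % side R * side R + side R := by omega
      _ = ((v 0 + ↑R).toNat % side R + 1) * side R := by ring
      _ ≤ side R * side R := Nat.mul_le_mul_right _ hx⟩

/-- Every enumerated site lies in the window. [folklore] -/
theorem boxXs_mem (R : ℕ) (i : Fin (boxN R)) : boxXs R i ∈ boxW R := by
  have hs := side_pos R
  have hside : side R = 2 * R + 1 := rfl
  have hq : i.val / side R < side R := Nat.div_lt_of_lt_mul (by have := i.isLt; unfold boxN at this; linarith [this])
  have hr : i.val % side R < side R := Nat.mod_lt _ hs
  rw [mem_boxW]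
  intro k
  fin_cases k
  · show -(R : ℤ) ≤ ((i.val / side R : ℕ) : ℤ) - R ∧ ((i.val / side R : ℕ) : ℤ) - R ≤ R
    generalize i.val / side R = q at hq ⊢
    constructor <;> omega
  · show -(R : ℤ) ≤ ((i.val % side R : ℕ) : ℤ) - R ∧ ((i.val % side R : ℕ) : ℤ) - R ≤ R
    generalize i.val % side R = ρ at hr ⊢
    constructor <;> omega

/-- **Read-back on the window**: `boxXs R (boxIx R v) = v` for `v ∈ boxW R`. [folklore] -/
theorem boxXs_boxIx (R : ℕ) (v : Site 2) (hv : v ∈ boxW R) : boxXs R (boxIx R v) = v := by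
  rw [mem_boxW] at hv
  obtain ⟨h0a, h0b⟩ := hv 0
  obtain ⟨h1a, h1b⟩ := hv 1
  have hs := side_pos R
  have e0 : (v 0 + R).toNat % side R = (v 0 + R).toNat := Nat.mod_eq_of_lt (by unfold side; omega)
  have e1 : (v 1 + R).toNat % side R = (v 1 + R).toNat := Nat.mod_eq_of_lt (by unfold side; omega)
  have hlt : (v 1 + R).toNat < side R := by unfold side; omega
  have hdiv : ((v 0 + ↑R).toNat * side R + (v 1 + ↑R).toNat) / side R = (v 0 + R).toNat := by
    rw [Nat.mul_comm, Nat.mul_add_div hs, Nat.div_eq_of_lt hlt, add_zero]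
  have hmod : ((v 0 + ↑R).toNat * side R + (v 1 + ↑R).toNat) % side R = (v 1 + R).toNat := by
    rw [Nat.mul_comm, Nat.mul_add_mod, Nat.mod_eq_of_lt hlt]
  unfold boxXs boxIx
  simp only [e0, e1, hdiv, hmod]
  funext k
  fin_cases k
  · show ((v 0 + ↑R).toNat : ℤ) - R = v 0
    omega
  · show ((v 1 + ↑R).toNat : ℤ) - R = v 1
    omega

/-- The enumeration is injective. [folklore] -/
theorem boxXs_injective (R : ℕ) : Function.Injective (boxXs R) := by
  intro i j h
  have hs := side_pos R
  have h0 := congrFun h 0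
  have h1 := congrFun h 1
  simp only [boxXs, Matrix.cons_val_zero, Matrix.cons_val_one] at h0 h1
  have hq : i.val / side R = j.val / side R := by omega
  have hr : i.val % side R = j.val % side R := by omega
  exact Fin.ext (by rw [← Nat.div_add_mod i.val (side R), ← Nat.div_add_mod j.val (side R), hq, hr])

/-- The enumeration covers the window. [folklore] -/
theorem boxXs_cover (R : ℕ) (y : Site 2) (hy : y ∈ boxW R) : ∃ i, boxXs R i = y := ⟨boxIx R y, boxXs_boxIx R y hy⟩

/-! ## Letter maps -/

/-- **The letter map of the box window**: index letters `Orb (Fin (boxN R))` → orbitals of `boxW R`. [folklore] -/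
noncomputable def boxD (R : ℕ) (p : Orb (Fin (boxN R))) : Orb (PolySite (boxW R)) :=
  orb (PolySite.pt (boxXs R (ofLex p).1) (boxXs_mem R (ofLex p).1)) (ofLex p).2

/-- `boxD` on a letter. [folklore] -/
theorem boxD_orb (R : ℕ) (i : Fin (boxN R)) (σ : Fin 2) : boxD R (orb i σ) = orb (PolySite.pt (boxXs R i) (boxXs_mem R i)) σ := rfl

/-- `boxD` is injective. [folklore] -/
theorem boxD_injective (R : ℕ) : Function.Injective (boxD R) := by
  intro p q h
  have h' : (PolySite.pt (boxXs R (ofLex p).1) (boxXs_mem R (ofLex p).1), (ofLex p).2) =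
      (PolySite.pt (boxXs R (ofLex q).1) (boxXs_mem R (ofLex q).1), (ofLex q).2) := congrArg ofLex h
  obtain ⟨hpt, hσ⟩ := Prod.mk.inj h'
  have hx : boxXs R (ofLex p).1 = boxXs R (ofLex q).1 := by
    have := congrArg (fun z : PolySite (boxW R) => ofLex z.1) hpt
    simpa using this
  have hi : (ofLex p).1 = (ofLex q).1 := boxXs_injective R hx
  have : ofLex p = ofLex q := Prod.ext hi hσ
  exact congrArg toLex this

/-- The spin of a letter is read off syntactically (the `hsp` hypothesis). [folklore] -/
theorem boxD_spin (R : ℕ) (a : Orb (Fin (boxN R))) : (ofLex (boxD R a)).2 = (ofLex a).2 := rfl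

/-- Membership-proof irrelevance for ordered sites. [folklore] -/
private theorem pt_congr_box {Λ : Finset (Site 2)} {x y : Site 2} (hx : x ∈ Λ) (hy : y ∈ Λ) (h : x = y) :
    PolySite.pt x hx = PolySite.pt y hy := by
  subst h; rfl

/-! ## Window inclusions -/

/-- Boxes are monotone. [folklore] -/
theorem boxW_mono {r R : ℕ} (h : r ≤ R) : boxW r ⊆ boxW R := thicken_mono _ (by exact_mod_cast h)

/-- The origin is in every box. [folklore] -/
theorem zero_mem_boxW (R : ℕ) : (0 : Site 2) ∈ boxW R := by
  rw [mem_boxW]; intro i; simp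

/-- **The `1`-thickening of a box is the next box**: `thicken (boxW r) 1 ⊆ boxW (r + 1)` (the `h8` hypothesis). [folklore] -/
theorem thicken_boxW_subset (r : ℕ) : thicken (boxW r) 1 ⊆ boxW (r + 1) := by
  intro x hx
  unfold thicken at hx
  simp only [Finset.mem_biUnion, Finset.mem_image, Nat.floor_one] at hx
  obtain ⟨y, hy, v, hv, rfl⟩ := hx
  rw [mem_boxW] at hy ⊢
  rw [mem_box] at hv
  intro i
  have := hy i; have := hv i
  simp only [Pi.add_apply, Nat.cast_add, Nat.cast_one]
  constructor <;> omega

/-- The unit window `thicken {0} 1` is `boxW 1` (the `h0` hypothesis reads `boxW 1 ⊆ boxW R`). [folklore] -/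
theorem thicken_zero_one_eq : thicken ({0} : Finset (Site 2)) 1 = boxW 1 := by
  unfold boxW; norm_num

/-! ## The push between two boxes and the `hf` hypothesis -/

/-- **The letter push** inner box `r` → outer box `R`: `(j, σ) ↦ (boxIx R (boxXs r j), σ)`. [folklore] -/
def boxPush (r R : ℕ) (b : Orb (Fin (boxN r))) : Orb (Fin (boxN R)) := orb (boxIx R (boxXs r (ofLex b).1)) (ofLex b).2

/-- **The push IS `Γ(incl)` on letters** (the `hf` hypothesis of the closers). [folklore] -/
theorem boxD_boxPush {r R : ℕ} (h : r ≤ R) (b : Orb (Fin (boxN r))) :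
    boxD R (boxPush r R b) = Orb.embMap (PolySite.incl (boxW_mono h)) (boxD r b) := by
  have hy : boxXs r (ofLex b).1 ∈ boxW R := boxW_mono h (boxXs_mem r _)
  show boxD R (orb (boxIx R (boxXs r (ofLex b).1)) (ofLex b).2) = _
  rw [boxD_orb, pt_congr_box (boxXs_mem R _) hy (boxXs_boxIx R _ hy)]
  rfl

/-! ## `D₄` invariance and the licensed-shift table fact -/

/-- The quarter turn preserves the box. [folklore] -/
theorem rot_mem_boxW {R : ℕ} {x : Site 2} (hx : x ∈ boxW R) : (![-x 1, x 0] : Site 2) ∈ boxW R := by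
  rw [mem_boxW] at hx ⊢
  intro i
  have h0 := hx 0; have h1 := hx 1
  fin_cases i
  · show -(R : ℤ) ≤ -x 1 ∧ -x 1 ≤ R
    constructor <;> omega
  · show -(R : ℤ) ≤ x 0 ∧ x 0 ≤ R
    exact h0

/-- The reflection preserves the box. [folklore] -/
theorem refl_mem_boxW {R : ℕ} {x : Site 2} (hx : x ∈ boxW R) : (![x 0, -x 1] : Site 2) ∈ boxW R := by
  rw [mem_boxW] at hx ⊢
  intro i
  have h0 := hx 0; have h1 := hx 1
  fin_cases i
  · show -(R : ℤ) ≤ x 0 ∧ x 0 ≤ R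
    exact h0
  · show -(R : ℤ) ≤ -x 1 ∧ -x 1 ≤ R
    constructor <;> omega

/-- **`D₄` maps the centred box to itself.** [cite: Han2020Bootstrap, §3] -/
theorem d4Vec_mem_boxW {R : ℕ} (γ : DihedralGroup 4) {x : Site 2} (hx : x ∈ boxW R) : d4Vec γ x ∈ boxW R := by
  have hrot : ∀ n : ℕ, ∀ x : Site 2, x ∈ boxW R → ((fun v : Site 2 => (![-v 1, v 0] : Site 2))^[n] x) ∈ boxW R := by
    intro n
    induction n with
    | zero => intro x hx; exact hx
    | succ n ih => intro x hx; rw [Function.iterate_succ_apply']; exact rot_mem_boxW (ih x hx)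
  cases γ with
  | r i => exact hrot i.val x hx
  | sr i => exact refl_mem_boxW (hrot i.val x hx)

/-- A shifted box site stays in a bigger box. [folklore] -/
theorem add_mem_boxW {r R : ℕ} {x v : Site 2} (hx : x ∈ boxW r) (hv : ∀ i, -((R : ℤ) - r) ≤ v i ∧ v i ≤ (R : ℤ) - r) :
    x + v ∈ boxW R := by
  rw [mem_boxW] at hx ⊢
  intro i
  have := hx i; have := hv i
  simp only [Pi.add_apply]
  constructor <;> omega

/-- **The validator of licensed moves for box geometries**: all eight `D₄` codes, shifts with `‖v‖∞ ≤ vmax`. [folklore] -/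
def boxOk (vmax : ℕ) (_γc : Fin 8) (v : ℤ × ℤ) : Bool := decide (-(vmax : ℤ) ≤ v.1 ∧ v.1 ≤ vmax ∧ -(vmax : ℤ) ≤ v.2 ∧ v.2 ≤ vmax)

/-- **THE TABLE FACT** (the `hokV` hypothesis of `affineOrbitLowerRowN_of_quot{,Adj}ChainKernelCertTB`): for `r + vmax ≤ R`, every
licensed move of every inner site reads back on the outer tables. [cite: Han2020Bootstrap, §3] -/
theorem box_hokV {r R vmax : ℕ} (h : r + vmax ≤ R) (γc : Fin 8) (v : ℤ × ℤ) (hok : boxOk vmax γc v = true) (j : Fin (boxN r)) :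
    boxXs R (boxIx R (d4Vec (d4OfCode γc) (boxXs r j) + siteOfPair v)) = d4Vec (d4OfCode γc) (boxXs r j) + siteOfPair v := by
  have hv : -(vmax : ℤ) ≤ v.1 ∧ v.1 ≤ vmax ∧ -(vmax : ℤ) ≤ v.2 ∧ v.2 ≤ vmax := of_decide_eq_true hok
  apply boxXs_boxIx
  apply add_mem_boxW (d4Vec_mem_boxW (d4OfCode γc) (boxXs_mem r j))
  intro i
  fin_cases i
  · show -((R : ℤ) - r) ≤ v.1 ∧ v.1 ≤ (R : ℤ) - r
    constructor <;> omega
  · show -((R : ℤ) - r) ≤ v.2 ∧ v.2 ≤ (R : ℤ) - r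
    constructor <;> omega

/-- Every moved inner window lies in the outer one (the `hsh` fact, if an instance wants it directly). [folklore] -/
theorem box_shiftSet_subset {r R vmax : ℕ} (h : r + vmax ≤ R) (γ : DihedralGroup 4) (v : Site 2)
    (hv : ∀ i, -(vmax : ℤ) ≤ v i ∧ v i ≤ vmax) : d4ShiftSet γ v (boxW r) ⊆ boxW R := by
  intro y hy
  rw [d4ShiftSet, Finset.mem_map] at hy
  obtain ⟨x, hx, rfl⟩ := hy
  apply add_mem_boxW (d4Vec_mem_boxW γ hx)
  intro i
  have := hv i
  constructor <;> omega

/-! ## The bundled tables -/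

/-- **The `QuotData` of a box geometry**: outer box `R`, inner box `r`, shifts `‖v‖∞ ≤ vmax`. [folklore] -/
def boxQuot (r R vmax : ℕ) : QuotData (boxN R) (boxN r) where
  xs := boxXs R
  ix := boxIx R
  xsβ := boxXs r
  f := boxPush r R
  ok := boxOk vmax

/-- The inner enumeration covers the inner window (the `hcovβ` hypothesis). [folklore] -/
theorem boxQuot_hcovβ (r R vmax : ℕ) : ∀ x ∈ boxW r, ∃ j, (boxQuot r R vmax).xsβ j = x := fun x hx => boxXs_cover r x hx

/-- The inner letter map agrees with the inner tables (the `hdΛ` hypothesis). [folklore] -/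
theorem boxQuot_hdΛ (r R vmax : ℕ) (j : Fin (boxN r)) (σ : Fin 2) :
    boxD r (orb j σ) = orb (PolySite.pt ((boxQuot r R vmax).xsβ j) (boxXs_mem r j)) σ := rfl

end BoxGeom

end CARPolyWindow

end Summit.Ventures.CertifiedManyBodySolver
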